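import Mathlib
import Summits.Ventures.PercRepro.TriangleCapVertexSpectrum
import Summits.Ventures.PercRepro.TriangleCapMiddleInterval
import Summits.Ventures.PercRepro.TriangleCapRowGapSet

/-!
# PercRepro — THE SUB-BANDS OF A LAYER: THE SECOND MAX-DEGREE LOWER BOUND (p3, gen 52; part 252)

A triangle-free graph `H` with `s` edges and a vertex `w` with `t = s − d(w)` off-edges sits in the band `t` at the
value `2 j` (`Σ d² + 2 t (s − t − 1) + 2 j = s (s + 1)`, i.e. `2·attach + offAdjPairs + 2 j = t (t + 1)`, part 252a of
gen 51).  The off-edges `F` form a triangle-free graph with `t` edges (`H.deleteIncidenceSet w`, whose degrees are the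
off-degrees `offDeg H w v`, part 203a) — so THE VERTEX BOUND APPLIES TO `F` ITSELF: at any vertex `x ≠ w` with
`offDeg H w x = t − u` it reads `offAdjPairs + 2 t + 2 u (t − u − 1) ≤ t (t + 1)`, hence

  **`u (t − u − 1) ≤ j`**  (`subband_lower_bound`):

the band `t` splits into the SUB-BANDS of the second max-degree `Δ(F) = t − u`, the sub-band `u` starting at
`u (t − u − 1)` (attained: the `(t − u)`-star at `x` plus a `u`-star at a second vertex, all ends in `N(w)` — the
`K_{2,u}` through `x`).  When every off-degree is `≤ 1` (`F` a matching) `offAdjPairs = 0` and `t (t − 1) ≤ 2 j`.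
These are the tools of the FIRST GAP of the band on `n` vertices (part 253): the values `ℓ ≤ j ≤ t − 3` are never
attained with `ℓ` non-neighbours of `w`.  Axioms: standard.
-/

namespace PercRepro

namespace TriangleCap

namespace C047

open Finset

variable {V : Type*} [Fintype V] [DecidableEq V]

/-- No off-edge contains `w`: `offDeg H w w = 0`. -/
theorem offDeg_self (H : SimpleGraph V) [DecidableRel H.Adj] (w : V) : offDeg H w w = 0 := by
  unfold offDeg
  rw [card_eq_zero, filter_eq_empty_iff]
  intro e he
  exact notMem_of_mem_offEdges H w he

/-- The degrees of `H.deleteIncidenceSet w` are the off-degrees of `w`. -/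
theorem deg_deleteIncidenceSet_eq_offDeg (H : SimpleGraph V) [DecidableRel H.Adj] (w v : V) :
    deg (H.deleteIncidenceSet w) v = offDeg H w v := by
  by_cases hv : v = w
  · subst hv
    rw [deg_deleteIncidenceSet_self, offDeg_self]
  · rw [deg_deleteIncidenceSet H w v hv, deg_eq_boole_add_offDeg H w v hv]
    by_cases h : H.Adj v w
    · rw [if_pos h, if_pos h.symm]
      omega
    · rw [if_neg h, if_neg (fun h' => h h'.symm)]
      omega

/-- `c * c = c * (c - 1) + c` in `ℕ`. -/
theorem mul_self_eq_mul_pred_add (c : ℕ) : c * c = c * (c - 1) + c := by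
  rcases c with _ | c
  · simp
  · rw [Nat.add_sub_cancel]
    ring

/-- **THE SQUARE SUM OF THE OFF-EDGE GRAPH:** `Σ_v d′(v)² = offAdjPairs + 2 t` for `H′ = H.deleteIncidenceSet w`
(`t = |F|`). -/
theorem sum_deg_sq_deleteIncidenceSet_eq_offAdjPairs (H : SimpleGraph V) [DecidableRel H.Adj] (w : V) :
    ∑ v, deg (H.deleteIncidenceSet w) v * deg (H.deleteIncidenceSet w) v =
      offAdjPairs H w + 2 * (offEdges H w).card := by
  simp_rw [deg_deleteIncidenceSet_eq_offDeg]
  rw [← add_sum_erase (univ : Finset V) _ (mem_univ w), offDeg_self, mul_zero, zero_add]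
  rw [← sum_erase_offDeg_mul_pred, ← sum_erase_offDeg, ← sum_add_distrib]
  apply sum_congr rfl
  intro v _
  exact mul_self_eq_mul_pred_add _

/-- The number of edges of `H.deleteIncidenceSet w` is the number of off-edges of `w`. -/
theorem card_edgeFinset_deleteIncidenceSet_eq_offEdges (H : SimpleGraph V) [DecidableRel H.Adj] (w : V) :
    (H.deleteIncidenceSet w).edgeFinset.card = (offEdges H w).card := by
  rw [SimpleGraph.card_edgeFinset_deleteIncidenceSet]
  have := card_offEdges_add_deg H w
  rw [deg_eq_degree] at this
  omega

/-- **THE SUB-BAND BOUND ON `offAdjPairs`:** in a triangle-free graph, at any vertex `x` with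
`offDeg H w x + u = t = |F|`, `offAdjPairs H w + 2 u (t − u − 1) ≤ t (t − 1)` (the vertex bound of the off-edge
graph at `x`). -/
theorem offAdjPairs_subband_bound (H : SimpleGraph V) [DecidableRel H.Adj] (hfree : H.CliqueFree 3) (w x : V)
    (t u : ℕ) (ht : (offEdges H w).card = t) (hx : offDeg H w x + u = t) :
    offAdjPairs H w + 2 * (u * (t - u - 1)) ≤ t * (t - 1) := by
  have hfree' : (H.deleteIncidenceSet w).CliqueFree 3 := hfree.anti (H.deleteIncidenceSet_le w)
  have hvb := sum_deg_sq_le_of_vertex (H.deleteIncidenceSet w) hfree' x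
  rw [sum_deg_sq_deleteIncidenceSet_eq_offAdjPairs, card_edgeFinset_deleteIncidenceSet_eq_offEdges,
    deg_deleteIncidenceSet_eq_offDeg, ht] at hvb
  have e1 : t - offDeg H w x = u := by omega
  have e2 : offDeg H w x - 1 = t - u - 1 := by omega
  rw [e1, e2] at hvb
  have e3 : t * (t + 1) = t * (t - 1) + 2 * t := by
    rcases t with _ | t
    · simp
    · rw [Nat.add_sub_cancel]
      ring
  omega

/-- **THE SUB-BAND LOWER BOUND:** a triangle-free graph with `s` edges, a vertex `w` with `t` off-edges at the band
value `2 j` (`Σ d² + 2 t (s − t − 1) + 2 j = s (s + 1)`) and a vertex `x` with `offDeg H w x + u = t` has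
`u (t − u − 1) ≤ j`. -/
theorem subband_lower_bound (H : SimpleGraph V) [DecidableRel H.Adj] (hfree : H.CliqueFree 3) (s t u j : ℕ)
    (hs : H.edgeFinset.card = s) (w : V) (hw : 1 ≤ deg H w) (ht : (offEdges H w).card = t)
    (hj : ∑ v, deg H v * deg H v + 2 * (t * (s - t - 1)) + 2 * j = s * (s + 1)) (x : V)
    (hx : offDeg H w x + u = t) :
    u * (t - u - 1) ≤ j := by
  have hval := (layer_value_iff H s t j hs w hw ht).mp hj
  have hatt := attach_le H hfree w
  rw [ht] at hatt
  have hP := offAdjPairs_subband_bound H hfree w x t u ht hx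
  have e3 : t * (t + 1) = t * (t - 1) + 2 * t := by
    rcases t with _ | t
    · simp
    · rw [Nat.add_sub_cancel]
      ring
  omega

/-- The sub-band lower bound in the `deg H w + t = s` form of the `n`-vertex theorems. -/
theorem subband_lower_bound' (H : SimpleGraph V) [DecidableRel H.Adj] (hfree : H.CliqueFree 3) (s t u j : ℕ)
    (hs : H.edgeFinset.card = s) (w : V) (hw : 1 ≤ deg H w) (ht : deg H w + t = s)
    (hj : ∑ v, deg H v * deg H v + 2 * (t * (s - t - 1)) + 2 * j = s * (s + 1)) (x : V)
    (hx : offDeg H w x + u = t) :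
    u * (t - u - 1) ≤ j := by
  have hcard := card_offEdges_add_deg H w
  exact subband_lower_bound H hfree s t u j hs w hw (by omega) hj x hx

/-- Every off-degree is at most `|F|`. -/
theorem offDeg_le_card (H : SimpleGraph V) [DecidableRel H.Adj] (w v : V) :
    offDeg H w v ≤ (offEdges H w).card :=
  card_le_card (filter_subset _ _)

/-- When every off-degree is `≤ 1` the off-edges form a matching: `offAdjPairs = 0`. -/
theorem offAdjPairs_eq_zero_of_offDeg_le_one (H : SimpleGraph V) [DecidableRel H.Adj] (w : V)
    (h : ∀ v, offDeg H w v ≤ 1) : offAdjPairs H w = 0 := by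
  rw [← sum_erase_offDeg_mul_pred]
  apply sum_eq_zero
  intro v _
  have := h v
  rcases Nat.le_one_iff_eq_zero_or_eq_one.mp this with h0 | h1
  · rw [h0]
    simp
  · rw [h1]
    simp

/-- **THE MATCHING BOUND:** at the band value `2 j` with every off-degree `≤ 1`, `t (t − 1) ≤ 2 j`. -/
theorem band_lower_bound_of_matching (H : SimpleGraph V) [DecidableRel H.Adj] (hfree : H.CliqueFree 3) (s t j : ℕ)
    (hs : H.edgeFinset.card = s) (w : V) (hw : 1 ≤ deg H w) (ht : (offEdges H w).card = t)
    (hj : ∑ v, deg H v * deg H v + 2 * (t * (s - t - 1)) + 2 * j = s * (s + 1))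
    (h : ∀ v, offDeg H w v ≤ 1) : t * (t - 1) ≤ 2 * j := by
  have hval := (layer_value_iff H s t j hs w hw ht).mp hj
  have hatt := attach_le H hfree w
  rw [ht] at hatt
  rw [offAdjPairs_eq_zero_of_offDeg_le_one H w h] at hval
  have e3 : t * (t + 1) = t * (t - 1) + 2 * t := by
    rcases t with _ | t
    · simp
    · rw [Nat.add_sub_cancel]
      ring
  omega

/-- The arithmetic of the first gap: `1 ≤ u ≤ t − 2` ⇒ `t − 2 ≤ u (t − u − 1)`. -/
theorem sub_two_le_mul (t u : ℕ) (hu1 : 1 ≤ u) (hu2 : u + 2 ≤ t) : t - 2 ≤ u * (t - u - 1) := by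
  obtain ⟨u', rfl⟩ : ∃ u', u = u' + 1 := ⟨u - 1, by omega⟩
  obtain ⟨v, rfl⟩ : ∃ v, t = u' + 1 + v + 2 := ⟨t - u' - 3, by omega⟩
  have e : u' + 1 + v + 2 - (u' + 1) - 1 = v + 1 := by omega
  have e' : u' + 1 + v + 2 - 2 = u' + v + 1 := by omega
  rw [e, e']
  nlinarith

/-- **BELOW THE STAR, THE BAND VALUE IS AT LEAST `t − 2`:** at the band value `2 j`, if no vertex carries all `t`
off-edges then `t ≤ j + 2`. -/
theorem band_ge_of_not_star (H : SimpleGraph V) [DecidableRel H.Adj] (hfree : H.CliqueFree 3) (s t j : ℕ)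
    (hs : H.edgeFinset.card = s) (w : V) (hw : 1 ≤ deg H w) (ht : (offEdges H w).card = t)
    (hj : ∑ v, deg H v * deg H v + 2 * (t * (s - t - 1)) + 2 * j = s * (s + 1))
    (hstar : ∀ x, offDeg H w x ≠ t) : t ≤ j + 2 := by
  by_cases h2 : ∃ x, 2 ≤ offDeg H w x
  · obtain ⟨x, hx⟩ := h2
    have hle := offDeg_le_card H w x
    rw [ht] at hle
    have hne := hstar x
    have hb := subband_lower_bound H hfree s t (t - offDeg H w x) j hs w hw ht hj x (by omega)
    have := sub_two_le_mul t (t - offDeg H w x) (by omega) (by omega)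
    omega
  · simp only [not_exists, not_le] at h2
    have hm := band_lower_bound_of_matching H hfree s t j hs w hw ht hj (fun v => by have := h2 v; omega)
    rcases t with _ | t'
    · omega
    · rw [Nat.add_sub_cancel] at hm
      nlinarith

end C047

end TriangleCap

end PercRepro
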